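import Literature.Claims.NS.Baev2022
import Summits.NavierStokesRegularity.NavierStokesRegularity.Theorems.SoloRefuteBaev2022Steps
import Literature.Analysis.FluidPDE.PressurePoisson
import Literature.Analysis.FluidPDE.ClassicalSolutionCalculus
import Literature.Analysis.FluidPDE.NormalisedPressureDischarge
import Literature.Analysis.FluidPDE.NSLerayHopfSereginEnergyProofs
import HarnessLib

/-!
# C113 `Baev2022` — the claimed theorem (Corollary-4 reading) is false as a sentence about
# Navier–Stokes: no classical solution with `p ≡ 0` issues from a localised planar strain

Kernel refutation of `Literature.Claims.NS.Baev2022.ClaimedTheorem` (Следствие 4 p.16 = Теорема 3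
p.15 for `n = 3` in the all-orders class `ℰ`, as the sentence reads: every smooth divergence-free
rapidly decreasing datum has a classical Navier–Stokes solution on `ℝ³ × [0,∞)` with pressure
identically `0`).

Witness: the compactly supported, divergence-free datum `w = ∇⊥(φ · x₀x₁) = (∂₁ψ, −∂₀ψ, 0)`,
`ψ = φ · x₀x₁`, `φ` a smooth bump `≡ 1` on the unit ball. Near the origin `w(x) = (x₀, −x₁, 0)`
(planar strain), so `div((w·∇)w)(0) = tr((∇w)²)(0) = 2`. If `v` were a classical solution with
`v(0) = w` and `p ≡ 0`, the tree's pressure Poisson equation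
(`laplacian_pressure_eq_of_isClassicalNSSolutionOn`, Tao 2011 (8)) at interior times gives
`div((v·∇)v)(t, 0) = −Δ0 = 0` for all `t > 0`; by joint smoothness up to `t = 0`
(`IsSmoothSpaceTimeOn.divergence_slice`) the same holds at `t = 0`, contradicting `2 ≠ 0`.

Consequences in the skeleton: Steps 4 and 5 (`PressureFreeExistence`, `DivFreePersists`) cannot
both hold (`claim_of_steps`), i.e. Step 5 fails granted the classical Step 4. The refutations of the
printed intermediate Steps 1 and 3 (`Eq12`, `Cor2`) are in `SoloRefuteBaev2022Steps.lean`.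
All statements proved ([folklore]); axioms `propext`, `Classical.choice`, `Quot.sound`.
Refuter: ns-claims-refuter-1; filed under convention (b) by the paired salvage prover.

WHAT THIS IS NOT: not a claim about NS regularity or blow-up; not a claim about any author beyond
the typed locator.
-/

set_option linter.dupNamespace false

noncomputable section

open Set Function Filter Topology Metric
open scoped ContDiff Laplacian InnerProductSpace RealInnerProductSpace
open Literature.Analysis.FluidPDE Literature.Claims.NS.Baev2022

namespace Summit.NavierStokesRegularity.NavierStokesRegularity.Theorems.Baev2022

/-! ## A. The datum `w = ∇⊥(φ · x₀x₁)` -/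

/-- Standard basis vector `eᵢ` of `ℝ³`. [folklore] -/
def bv (i : Fin 3) : E3 := EuclideanSpace.single i (1 : ℝ)

/-- Coordinates of the basis vectors. [folklore] -/
@[simp] theorem bv_apply (i j : Fin 3) : bv i j = if j = i then 1 else 0 := by
  simp [bv]

/-- A smooth bump at the origin, `≡ 1` on the unit ball, supported in radius `2`. [folklore] -/
def bumpB : ContDiffBump (0 : E3) := ⟨1, 2, one_pos, one_lt_two⟩

/-- The planar strain potential `x₀x₁`. [folklore] -/
def quadB (x : E3) : ℝ := x 0 * x 1

/-- The stream function `ψ = φ · x₀x₁`. [folklore] -/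
def strB (x : E3) : ℝ := bumpB x * quadB x

/-- `x₀x₁` is smooth. [folklore] -/
theorem quadB_contDiff {n : ℕ∞} : ContDiff ℝ n quadB :=
  ((EuclideanSpace.proj (0 : Fin 3) : E3 →L[ℝ] ℝ).contDiff).mul
    ((EuclideanSpace.proj (1 : Fin 3) : E3 →L[ℝ] ℝ).contDiff)

/-- `ψ` is smooth. [folklore] -/
theorem strB_contDiff {n : ℕ∞} : ContDiff ℝ n strB := bumpB.contDiff.mul quadB_contDiff

/-- `ψ` has compact support. [folklore] -/
theorem strB_hasCompactSupport : HasCompactSupport strB := bumpB.hasCompactSupport.mul_right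

/-- The map `T ↦ (T e₁) e₀ − (T e₀) e₁`, so that `rotB ∘ Dψ = (∂₁ψ, −∂₀ψ, 0) = ∇⊥ψ`. [folklore] -/
def rotB : (E3 →L[ℝ] ℝ) →L[ℝ] E3 :=
  (ContinuousLinearMap.apply ℝ ℝ (bv 1)).smulRight (bv 0) -
    (ContinuousLinearMap.apply ℝ ℝ (bv 0)).smulRight (bv 1)

/-- Unfolding `rotB`. [folklore] -/
@[simp] theorem rotB_apply (T : E3 →L[ℝ] ℝ) : rotB T = (T (bv 1)) • bv 0 - (T (bv 0)) • bv 1 := by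
  simp [rotB]

/-- THE DATUM: the localised planar strain `w = ∇⊥(φ · x₀x₁)`. [folklore] -/
def wB (x : E3) : E3 := rotB (fderiv ℝ strB x)

/-- `Dψ` is smooth. [folklore] -/
theorem fderiv_strB_contDiff {n : ℕ∞} : ContDiff ℝ n (fderiv ℝ strB) :=
  (strB_contDiff (n := n + 1)).fderiv_right (m := n) (by norm_cast)

/-- `w` is smooth. [folklore] -/
theorem wB_contDiff {n : ℕ∞} : ContDiff ℝ n wB := rotB.contDiff.comp fderiv_strB_contDiff

/-- `w` has compact support. [folklore] -/
theorem wB_hasCompactSupport : HasCompactSupport wB := by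
  show HasCompactSupport (rotB ∘ fderiv ℝ strB)
  exact (strB_hasCompactSupport.fderiv (𝕜 := ℝ)).comp_left (map_zero rotB)

/-- The derivative of `w`. [folklore] -/
theorem hasFDerivAt_wB (x : E3) : HasFDerivAt wB (rotB.comp (fderiv ℝ (fderiv ℝ strB) x)) x :=
  rotB.hasFDerivAt.comp x
    (((fderiv_strB_contDiff (n := 1)).differentiable (by norm_num) x).hasFDerivAt)

/-- Symmetry of `D²ψ`. [folklore] -/
theorem symm_strB (x : E3) (v w : E3) :
    fderiv ℝ (fderiv ℝ strB) x v w = fderiv ℝ (fderiv ℝ strB) x w v :=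
  ((strB_contDiff (n := 2)).contDiffAt.isSymmSndFDerivAt (by simp)) v w

/-- `w` is divergence free: `div ∇⊥ψ = ∂₀∂₁ψ − ∂₁∂₀ψ = 0`. [folklore] -/
theorem wB_isDivFree : VectorCalculus.IsDivFree wB := by
  intro x
  rw [divergence_eq_sum_inner_fderiv (EuclideanSpace.basisFun (Fin 3) ℝ), (hasFDerivAt_wB x).fderiv]
  have hs := symm_strB x (bv 0) (bv 1)
  simp only [Fin.sum_univ_three, EuclideanSpace.basisFun_apply, ContinuousLinearMap.coe_comp,
    Function.comp_apply, rotB_apply]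
  simp only [bv, inner_sub_right, inner_smul_right, EuclideanSpace.inner_single_left] at hs ⊢
  simp [Fin.ext_iff] at hs ⊢
  linarith [hs]

/-- `w` is an admissible datum of the skeleton (class `ℰ` with (10)): smooth, divergence free,
rapidly decreasing (compact support). [folklore] -/
theorem isDatum_wB : IsDatum wB :=
  ⟨wB_contDiff, fun x => wB_isDivFree x,
    HasRapidSpatialDecay.of_hasCompactSupport wB_contDiff wB_hasCompactSupport⟩

/-! ## B. The local model: `w = (x₀, −x₁, 0)` on the unit ball, `div((w·∇)w)(0) = 2` -/

/-- The linear strain `L y = y₀ e₀ − y₁ e₁`. [folklore] -/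
def Ls : E3 →L[ℝ] E3 :=
  (EuclideanSpace.proj (𝕜 := ℝ) (0 : Fin 3) : E3 →L[ℝ] ℝ).smulRight (bv 0) -
    (EuclideanSpace.proj (𝕜 := ℝ) (1 : Fin 3) : E3 →L[ℝ] ℝ).smulRight (bv 1)

/-- `L y = y₀ e₀ − y₁ e₁`. [folklore] -/
@[simp] theorem Ls_apply (y : E3) : Ls y = (y 0) • bv 0 - (y 1) • bv 1 := by
  simp [Ls, ContinuousLinearMap.smulRight_apply]

/-- On the unit ball the bump is `1`, so `ψ = x₀x₁` near every point of the ball. [folklore] -/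
theorem strB_eventuallyEq {y : E3} (hy : y ∈ ball (0 : E3) 1) : strB =ᶠ[𝓝 y] quadB := by
  filter_upwards [isOpen_ball.mem_nhds hy] with z hz
  rw [strB, bumpB.one_of_mem_closedBall (ball_subset_closedBall hz), one_mul]

/-- The derivative of `x₀x₁`. [folklore] -/
theorem hasFDerivAt_quadB (y : E3) :
    HasFDerivAt quadB ((y 0) • (EuclideanSpace.proj (1 : Fin 3) : E3 →L[ℝ] ℝ) +
      (y 1) • (EuclideanSpace.proj (0 : Fin 3) : E3 →L[ℝ] ℝ)) y := by
  have hc : ∀ j : Fin 3,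
      HasFDerivAt (fun z : E3 => z j) (EuclideanSpace.proj j : E3 →L[ℝ] ℝ) y := fun j =>
    (EuclideanSpace.proj j : E3 →L[ℝ] ℝ).hasFDerivAt
  exact (hc 0).mul (hc 1)

/-- `Dψ` on the unit ball. [folklore] -/
theorem fderiv_strB_of_mem {y : E3} (hy : y ∈ ball (0 : E3) 1) :
    fderiv ℝ strB y = (y 0) • (EuclideanSpace.proj (1 : Fin 3) : E3 →L[ℝ] ℝ) +
      (y 1) • (EuclideanSpace.proj (0 : Fin 3) : E3 →L[ℝ] ℝ) := by
  rw [(strB_eventuallyEq hy).fderiv_eq]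
  exact (hasFDerivAt_quadB y).fderiv

/-- `w = L` on the unit ball. [folklore] -/
theorem wB_of_mem {y : E3} (hy : y ∈ ball (0 : E3) 1) : wB y = Ls y := by
  rw [wB, fderiv_strB_of_mem hy, rotB_apply, Ls_apply]
  simp

/-- `w = L` near every point of the unit ball. [folklore] -/
theorem wB_eventuallyEq {y : E3} (hy : y ∈ ball (0 : E3) 1) : wB =ᶠ[𝓝 y] fun z => Ls z := by
  filter_upwards [isOpen_ball.mem_nhds hy] with z hz using wB_of_mem hz

/-- `Dw = L` on the unit ball. [folklore] -/
theorem fderiv_wB_of_mem {y : E3} (hy : y ∈ ball (0 : E3) 1) : fderiv ℝ wB y = Ls := by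
  rw [(wB_eventuallyEq hy).fderiv_eq]
  exact Ls.fderiv

/-- `(w·∇)w = L(L y) = (y₀, y₁, 0)` on the unit ball. [folklore] -/
theorem convect_wB_of_mem {y : E3} (hy : y ∈ ball (0 : E3) 1) : convect wB wB y = Ls (Ls y) := by
  show fderiv ℝ wB y (wB y) = Ls (Ls y)
  rw [fderiv_wB_of_mem hy, wB_of_mem hy]

/-- `(w·∇)w = L ∘ L` near the origin. [folklore] -/
theorem convect_wB_eventuallyEq : convect wB wB =ᶠ[𝓝 (0 : E3)] fun y => (Ls.comp Ls) y := by
  filter_upwards [isOpen_ball.mem_nhds (mem_ball_self one_pos)] with z hz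
  rw [convect_wB_of_mem hz]
  rfl

/-- **`div((w·∇)w)(0) = tr(L²) = 2`.** [folklore] -/
theorem divergence_convect_wB : VectorCalculus.divergence (convect wB wB) 0 = 2 := by
  rw [divergence_eq_sum_inner_fderiv (EuclideanSpace.basisFun (Fin 3) ℝ),
    convect_wB_eventuallyEq.fderiv_eq, (Ls.comp Ls).fderiv]
  simp only [Fin.sum_univ_three, EuclideanSpace.basisFun_apply, ContinuousLinearMap.coe_comp,
    Function.comp_apply, Ls_apply]
  simp [bv]
  norm_num

/-! ## C. The claimed theorem is false -/

/-- The Laplacian of the zero scalar field vanishes. [folklore] -/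
theorem laplacian_zero_apply (x : E3) : Δ (fun _ : E3 => (0 : ℝ)) x = 0 := by
  rw [laplacian_eq_sum_fderiv_fderiv (EuclideanSpace.basisFun (Fin 3) ℝ) contDiff_const]
  simp

/-- **The claimed theorem (Corollary-4 reading) is false**: no classical Navier–Stokes solution
with pressure `≡ 0` issues from the datum `w` — the pressure Poisson equation would force
`div((v·∇)v)(t, 0) = 0` for `t > 0`, hence at `t = 0` by continuity, against
`div((w·∇)w)(0) = 2`. [cite: Baev2022ru, Следствие 4 p.16; Теорема 3 p.15] -/
theorem not_ClaimedTheorem : ¬ Literature.Claims.NS.Baev2022.ClaimedTheorem := by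
  intro h
  obtain ⟨v, ⟨hsm, hns⟩, -, -⟩ := h 1 one_pos wB isDatum_wB
  have hp0 : IsSmoothOnHalfSpace (fun (_ : ℝ) (_ : E3) => (0 : ℝ)) := contDiffOn_const
  obtain ⟨hcl, h0⟩ := isNavierStokesSolution_and_smooth_iff.1 ⟨hns, hsm, hp0⟩
  -- the source of the pressure Poisson equation vanishes at interior times
  have hsrc : ∀ t : ℝ, 0 < t → VectorCalculus.divergence (convect (v t) (v t)) 0 = 0 := by
    intro t ht
    have hti : t ∈ interior (Ici (0 : ℝ)) := by
      rw [interior_Ici]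
      exact ht
    have hP := laplacian_pressure_eq_of_isClassicalNSSolutionOn hcl hti (0 : E3)
    have hΔ : Δ ((fun (_ : ℝ) (_ : E3) => (0 : ℝ)) t) (0 : E3) = 0 := laplacian_zero_apply 0
    have hf : VectorCalculus.divergence ((0 : ℝ → E3 → E3) t) (0 : E3) = 0 :=
      divergence_zeroField 0
    rw [hΔ, hf] at hP
    linarith
  -- the source is continuous up to `t = 0`
  set g : ℝ → ℝ := fun t => VectorCalculus.divergence (convect (v t) (v t)) 0 with hg
  have hS : UniqueDiffOn ℝ (Ici (0 : ℝ)) := uniqueDiffOn_Ici 0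
  have hj : IsSmoothSpaceTimeOn (Ici 0)
      (fun t y => VectorCalculus.divergence (convect (v t) (v t)) y) :=
    (hcl.smooth_velocity.convect hcl.smooth_velocity hS).divergence_slice hS
  have hcont : ContinuousWithinAt g (Ici 0) 0 := by
    have hc : ContinuousWithinAt
        (uncurry fun t y => VectorCalculus.divergence (convect (v t) (v t)) y)
        (Ici 0 ×ˢ univ) ((0 : ℝ), (0 : E3)) :=
      hj.continuousOn _ (mk_mem_prod Set.self_mem_Ici (mem_univ _))
    have hemb : ContinuousWithinAt (fun t : ℝ => ((t, (0 : E3)) : ℝ × E3)) (Ici 0) 0 :=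
      (continuous_id.prodMk continuous_const).continuousWithinAt
    have hmaps : MapsTo (fun t : ℝ => ((t, (0 : E3)) : ℝ × E3)) (Ici 0) (Ici 0 ×ˢ univ) :=
      fun t ht => ⟨ht, mem_univ _⟩
    exact ContinuousWithinAt.comp (f := fun t : ℝ => ((t, (0 : E3)) : ℝ × E3)) hc hemb hmaps
  -- it vanishes for `t > 0`, hence at `t = 0`
  have hlim0 : Tendsto g (𝓝[>] 0) (𝓝 (g 0)) := (hcont.mono Ioi_subset_Ici_self).tendsto
  have hlim1 : Tendsto g (𝓝[>] 0) (𝓝 0) := by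
    apply tendsto_const_nhds.congr'
    filter_upwards [self_mem_nhdsWithin] with t ht
    exact (hsrc t ht).symm
  have hg0 : g 0 = 0 := tendsto_nhds_unique hlim0 hlim1
  -- but at `t = 0` the source is `div((w·∇)w)(0) = 2`
  have hg2 : g 0 = 2 := by
    show VectorCalculus.divergence (convect (v 0) (v 0)) 0 = 2
    rw [h0]
    exact divergence_convect_wB
  rw [hg2] at hg0
  norm_num at hg0

/-- **Steps 4 and 5 cannot both hold**: they compose to the claimed theorem (`claim_of_steps`).
[cite: Baev2022ru, proof of Теорема 3 pp.15–16] -/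
theorem not_pressureFreeExistence_and_divFreePersists :
    ¬ (Literature.Claims.NS.Baev2022.PressureFreeExistence ∧
      Literature.Claims.NS.Baev2022.DivFreePersists) :=
  fun h => not_ClaimedTheorem (claim_of_steps h.1 h.2)

/-- **Step 5 fails granted Step 4**: if the pressure-free system is globally solvable in `ℰ`
(the classical parabolic Step 4), then incompressibility does NOT persist along it.
[cite: Baev2022ru, p.10 «учтено условие несжимаемости в виде |g| = 1»; Теорема 3 p.15] -/
theorem not_divFreePersists_of_pressureFreeExistence
    (h₄ : Literature.Claims.NS.Baev2022.PressureFreeExistence) :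
    ¬ Literature.Claims.NS.Baev2022.DivFreePersists :=
  fun h₅ => not_ClaimedTheorem (claim_of_steps h₄ h₅)

end Summit.NavierStokesRegularity.NavierStokesRegularity.Theorems.Baev2022

end

-- WHAT THIS IS NOT: not a claim about NS regularity or blow-up; not a claim about any author
-- beyond the typed locator.
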